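import Literature.NumberTheory.EllipticCurves.ManinConstantQuadraticTwist
import HarnessLib
import HarnessLib.Audit.Tags

/-!
# Candidates E-imc-27 / E-imc-28 / E-imc-29: the `p = 2` RESIDUE of the Shimura-subgroup Hecke congruence — the
# `m² + 4` FAMILY (`FourPFamilyManinEven`, `FourPFamilyOptimalOddDegree`) and the CLASSIFICATION of even Manin
# constants at levels `4 ∣ N` (`EvenManinConstantLevelClassification`) — cell `bsd-f2-manin` (D-0131 (3) frontier:
# the Manin constant at additive primes). `@[conjecture]` leaf (NOTHING asserted; definitions only; the planner's
# abbreviations `fourPFamilyCurve m = ⟨0, m, 0, −1, 0⟩` and `fourPFamilyLevel m = (if m % 4 = 1 then 4 else 16)·(m²+4)`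
# are INLINED).

HONEST FRAMING. LENS = Iwasawa-main-conjecture / family-integrality on the Shimura subgroup (planner-of-record
`bsd-f2-manin-imc` g5, HOME `run/shared/lean/pub/bsd-f2-manin/MEMO-imc.md` §13.8; Props VERBATIM from
HOME/imc/Sketch-imc-g5.lean sha16 d8066faab1768902 with the two abbreviations inlined, farm rc 0).  CONTEXT: the tree's
`ShimuraSubgroupHeckeCongruence.lean` (THEOREM W) leaves, at a level with exactly one additive prime `p`, the question
«which `μ_p ⊂ Σ(N)` lie on `E₀`».  BC5 WITNESS (HOME/imc/g5-residue2.out, g5-families.out; Cremona `opt_man`, `N < 5·10⁵`,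
after the E-imc-19 correction): the 94 classes with `4 ∣ N` containing a curve with EVEN Manin constant are EXACTLY
(i) 55 classes at `N = 4p`, `p = m² + 4` prime, `m ≡ 1 (mod 4)` — and conversely EVERY prime `p = m² + 4 < 125 000`
occurs (55/55): the class of `E_m : y² = x³ + m x² − x` (Kodaira IV at 2, `c = 2`), whose `X₀(4p)`-optimal curve is
`E_m / ⟨(0,0)⟩ : y² = x³ − 2m x² + p x` (Kodaira IV*, ODD modular degree in 55/55; `20a, 52a, 116c, 212b, 692a, …`);
(ii) 31 classes at `N = 16p`, `p = m² + 4` prime, `m ≡ 3 (mod 4)` — every such `p < 31 250` (31/31): the same `E_m`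
(`80b`, `208c`, `464e`, …); (iii) 8 sporadic classes `24a, 32a, 40a, 48a, 64a, 80a, 128b, 128d` (`E_m` for `m ∈ {0, ±2}`,
`G_m : y² = x³ + m x² + x` for `|m| ≤ 3`).  Independently re-derived by refuter-1 (HOME/REFUTER-ref1.md §R21, 19:25Z;
exact `(c₄, c₆)` match 55/55).  IN PRINT / NOT (refuter-2 g5, R-imc-13/14, ref2/LIT-PLACEMENT v6 §L⁶): the family
and its models are in print parity-side (Yazdani, *Modular abelian varieties of odd modular degree*, Thm 3.8(4):
`N = 4p` with odd congruence number ⇒ `p = m² + 4`, `E ~ y² = x³ + m x² − x`; Ivorra 2004 Thm 2; the converse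
«expected … we do not yet know of a proof», Yazdani p. 61 = a printed OPEN QUESTION); Stein–Watkins 2002 §4
«three 2-isogeny families» (text NOT held, acq-09831; second-hand Watkins 2002 p. 9); the MANIN side (even `c`, the
classification, the `16p` sub-family, the degenerate list) is NOT in print.  Refuter verdicts: REF1 **SURVIVES ×3**
(§R21; BC7 CLEAN; read-back: `E′_m = E_m/⟨(0,0)⟩` minimal with `v₂Δ = 8`, IV* at 2 for `m ≡ 1 (4)` (Tate, `|m| ≤ 401`);
the ∃-form of E-imc-28 needs modularity data — honest conjecture; in E-imc-29 `D` = min-degree parametrisation at the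
conductor, `80` caught by `16·(1² + 4)`, the family disjunct does not tie `v₂N` to `m mod 4` — weaker = safe);
REF2: E-imc-27 **variant (pending SW02 text)**, E-imc-28 = **printed OPEN QUESTION** (parity converse), E-imc-29
**NOT-IN-PRINT; new-in-statement (data law)**; beyond-print NO (laws).  Optional data ask A-imc-6 (es kit j287823:
the 30 family levels in `(5·10⁵, 10⁶)`, prediction `c(E_m) = 2`, odd degree, IV* optimal).
-/

noncomputable section

open scoped MatrixGroups ModularForm

open CongruenceSubgroup WeierstrassCurve
  Literature.NumberTheory.EllipticCurves Literature.NumberTheory.EllipticCurves.ModularForms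

namespace Summit.BirchSwinnertonDyer.Rank1Residual.ManinAdditive

/-- **Candidate E-imc-27 `FourPFamilyManinEven` (cell bsd-f2-manin, MEMO-imc §13.8; the `m² + 4` family GAINS —
NOT in print on the Manin side, nothing asserted):** for every odd `m` with `p = m² + 4` prime, EVERY modular
parametrisation of `E_m : y² = x³ + m x² − x` (inlined `⟨0, m, 0, −1, 0⟩`) by `X₀(N_m)`, `N_m = 4p` for
`m ≡ 1 (mod 4)` and `16p` otherwise (inlined `(if m % 4 = 1 then 4 else 16)·(m² + 4)`), has an EVEN Manin constant
(`= 2` given `c₀ = 1`; all parametrisations are `λ ∘ φ₀`, so their constants are the multiples of the least one).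
BC5: Cremona `opt_man`: `c(E_m) = 2` at all 55 levels `4(m² + 4) < 5·10⁵` and all 31 levels `16(m² + 4) < 5·10⁵`
(86/86, both directions); beyond the table open in print (Yazdani, after Thm 3.8: even the oddness of the congruence
number is «expected», proved only for Neumann–Setzer curves via Mazur / Mestre–Oesterlé).  Why it might fail: an
`m` with `m² + 4` prime beyond `5·10⁵/4` where the IV curve `E_m` itself is `X₀`-optimal (`c = 1` throughout the
class), i.e. `E₀ ∩ Σ(4p) = 0`.
[cite: Yazdani2009, Thm. 3.8 and §3.5 (shape only: the m² + 4 family on the PARITY side; the even-Manin-constant statement is NOT in print — cell bsd-f2-manin MEMO-imc.md §13.8, E-imc-27; ref2: variant pending Stein–Watkins 2002 §4, acq-09831)]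
[cite: SteinWatkins2004, Prop. 3.2 (the Neumann–Setzer / prime-level companion)] [cite: Cremona2022ManinConstants, opt_man] -/
@[conjecture] def FourPFamilyManinEven : Prop :=
  ∀ (m : ℤ) [NeZero ((if m % 4 = 1 then 4 else 16) * (m ^ 2 + 4).toNat)], Odd m →
    Nat.Prime (m ^ 2 + 4).toNat →
    ∀ D : ModularParametrizationData (⟨0, (m : ℚ), 0, -1, 0⟩ : WeierstrassCurve ℚ)
      ((if m % 4 = 1 then 4 else 16) * (m ^ 2 + 4).toNat), (2 : ℤ) ∣ D.c

/-- **Candidate E-imc-28 `FourPFamilyOptimalOddDegree` (cell bsd-f2-manin, MEMO-imc §13.8; the OPTIMAL side of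
E-imc-27 at `N = 4p` — its parity half is a printed OPEN QUESTION (Yazdani p. 61), nothing asserted):** for
`m ≡ 1 (mod 4)` with `p = m² + 4` prime, the IV* curve `E′_m : y² = x³ − 2m x² + p x` admits an
`X₀(4p)`-parametrisation with Manin constant `1`, lattice-optimal (`Λ_{E′} = Λ₀(f)`: `E′_m` IS the optimal curve)
and of ODD degree.  BC5: 55/55 (`opt_man` code 1 on the IV* curve; `alldegphi` odd: `20a:1, 52a:3, 116c:15, 212b:21,
692a:123, …`; exact `(c₄, c₆)` match by refuter-1; the only other odd-degree optimal curves with `4 ∣ N` and a rational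
2-isogeny below `5·10⁵` number 1).  Why it might fail: Watkins-parity heuristics give no reason for the degree to stay
odd for all `m`; a single even degree or a non-optimal IV* curve kills it.
[cite: Yazdani2009, Thm. 2.15, Thm. 3.8 and p. 61 (the parity converse is stated there as an open expectation; the optimality / Manin half is NOT in print — cell bsd-f2-manin MEMO-imc.md §13.8, E-imc-28)]
[cite: CalegariEmerton2009, Thm. 1.1] [cite: Cremona2022ManinConstants, opt_man and alldegphi] -/
@[conjecture] def FourPFamilyOptimalOddDegree : Prop :=
  ∀ (m : ℤ) (p : ℕ) [NeZero (4 * p)], m % 4 = 1 → (p : ℤ) = m ^ 2 + 4 → p.Prime →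
    ∃ D : ModularParametrizationData (⟨0, -2 * (m : ℚ), 0, (p : ℚ), 0⟩ : WeierstrassCurve ℚ) (4 * p),
      D.c = 1 ∧ Odd D.deg ∧ ∀ z ∈ D.L.lattice, z ∈ periodLattice D.f

/-- **Candidate E-imc-29 `EvenManinConstantLevelClassification` (cell bsd-f2-manin, MEMO-imc §13.8; the
CLASSIFICATION of even Manin constants at levels divisible by 4 — a DATA LAW extrapolating `N < 5·10⁵`, NOT in
print, nothing asserted):** if a globally minimal `W` with `4 ∣ N_W` has an even Manin constant at a MINIMAL-DEGREE
parametrisation of level `N_W` (`∀ D′, D.deg ≤ D′.deg`), then `N_W = 4(m² + 4)` or `16(m² + 4)` with `m² + 4` prime,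
or `N_W ∈ {24, 32, 40, 48, 64, 128}`.  BC5: Cremona `opt_man`, `N < 5·10⁵`: the curves with `2 ∣ c` and `4 ∣ N` lie
in exactly 94 classes: 55 at `4(m² + 4)`, 31 at `16(m² + 4)`, `80a, 80b` (`80 = 16·(1 + 4)`), and `24a, 32a, 40a,
48a, 64a, 128b, 128d`; none at `v₂(N) ∈ {3, 5, 6, 7, 8}` apart from these, none with `9 ∣ N`.  (With the tree's
THEOREM W + Stevens: `4 ∣ N` forces every Manin multiplier in the class to be a power of 2, so this is the whole story
at such levels.)  Why it might fail: a gain class at a level `4M` with `M` composite, or the `m² + 4` pattern broken,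
beyond `5·10⁵` — e.g. an `E₀ ⊃ μ₂ ⊂ Σ(4pq)`.
[cite: Yazdani2009, Thm. 3.8 (shape only: the shape of N for ODD CONGRUENCE NUMBER — p, pq, 2p, 4p, 8p^a; the even-Manin-constant level classification is NOT in print — cell bsd-f2-manin MEMO-imc.md §13.8, E-imc-29; ref2: new-in-statement data law)]
[cite: Cremona2022ManinConstants, opt_man / manin.txt] -/
@[conjecture] def EvenManinConstantLevelClassification : Prop :=
  ∀ (W : WeierstrassCurve ℚ) [W.IsElliptic] [W.IsGloballyMinimal] [NeZero (W.conductorNorm ℤ)]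
    (D : ModularParametrizationData W (W.conductorNorm ℤ)),
    (∀ D' : ModularParametrizationData W (W.conductorNorm ℤ), D.deg ≤ D'.deg) → (2 : ℤ) ∣ D.c →
    4 ∣ W.conductorNorm ℤ →
    (∃ m : ℤ, Nat.Prime (m ^ 2 + 4).toNat ∧
        (W.conductorNorm ℤ = 4 * (m ^ 2 + 4).toNat ∨ W.conductorNorm ℤ = 16 * (m ^ 2 + 4).toNat)) ∨
      W.conductorNorm ℤ ∈ ({24, 32, 40, 48, 64, 128} : Finset ℕ)

end Summit.BirchSwinnertonDyer.Rank1Residual.ManinAdditive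

end
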